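import Literature.NumberTheory.EllipticCurves.HeegnerModuleScalingProofs
import Literature.NumberTheory.EllipticCurves.IwasawaAlgebraDivisibilityProofs
import HarnessLib

/-!
# The Heegner module of a rescaled parametrisation, II: any `m ≠ 0` — the sandwich
# `(C m) • ℋ_∞(F) ⊆ ℋ_∞(m • F) ⊆ ℋ_∞(F)`, `I(ℋ_∞(F)) ∣ I(ℋ_∞(m • F))`, and the transport of Howard's
# Thm. B (c) / eq. (2), in the tree's shape, along rescalings

Sequel to `HeegnerModuleScalingProofs` (there: `ℋ̄_k(m • F) = m • ℋ̄_k(F)` for any `m`, and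
`ℋ_∞(m • F) = ℋ_∞(F)`, `I(ℋ_∞)` unchanged, for `p ∤ m`). Howard 2004 fixes an ARBITRARY modular
parametrisation ("Fixing a modular parametrization of `E` by `X_0(N)` yields a family of points
`P[n] ∈ E(K[n])`", Compositio 140, §1) and proves, for the Heegner module `𝐇` it generates, the
DIVISIBILITY `ch(M) ∣ ch(H¹_{F_Λ}(K, 𝐓)/𝐇)` (Thm. B (c)) and the BOUND
`rank_{ℤ_p} S_p(E/K) ≤ 1 + 2 ord_J ch(H¹_{F_Λ}(K, 𝐓)/𝐇)` (eq. (2)). The tree types both conclusions for all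
Heegner families at once (`Howard2004_thmB`, `Howard2004_selmerCorank_le`: `∀ (F : HeegnerFamily …)`).
This file certifies that this layout is print-consistent — the instance of either BODY at `F` implies the
instance at every rescaled family `F.zsmul Dt' m` (`m ≠ 0`), because rescaling can only shrink the Heegner
module, hence only make `I(ℋ_∞)` more divisible and `ord_J` larger — in contrast with the integral EQUALITY
binders of the Heegner point main conjecture (`KellerYin2024.false_of_thm521_OPEN_of_witness`,
`ModularParametrizationScalingProofs`):

* `WeierstrassCurve.LambdaAdicSelmerData.proj_C_intCast_smul`: `proj_k ((C m) • s) = m • proj_k s`;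
* `heegnerModule_zsmul_le`, `C_smul_mem_heegnerModule_zsmul`: the sandwich
  `(C m) • ℋ_∞(F) ⊆ ℋ_∞(m • F) ⊆ ℋ_∞(F)` (from `heegnerModuleLayer_zsmul`);
* `isTorsion_quotient_heegnerModule_zsmul`: `𝔖/ℋ_∞(m • F)` is torsion when `𝔖/ℋ_∞(F)` is (`m ≠ 0`);
* `heegnerCharIdeal_dvd_zsmul`, `heegnerCharIdeal_sq_dvd_zsmul`: **`I(ℋ_∞(F)) ∣ I(ℋ_∞(m • F))`** for `𝔖`
  finitely generated and `𝔖/ℋ_∞(F)` torsion — multiplicativity of `char` (tree theorem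
  `Module.charIdeal_eq_mul_of_exact`) on `0 → ℋ_∞(F)/ℋ_∞(m • F) → 𝔖/ℋ_∞(m • F) → 𝔖/ℋ_∞(F) → 0`;
* `heegnerModuleIndex_le_zsmul`: `ord_J I(ℋ_∞(F)) ≤ ord_J I(ℋ_∞(m • F))` (local lengths are monotone
  under the surjection `𝔖/ℋ_∞(m • F) ↠ 𝔖/ℋ_∞(F)`);
* `dvd_heegnerCharIdeal_sq_zsmul`: for `𝔖` f.g. torsion-free of rank one (Thm. B, first sentence) and any
  ideal `I`, `I ∣ I(ℋ_∞(F))² ⇒ I ∣ I(ℋ_∞(m • F))²` — if `ℋ_∞(F) = 0` both ideals coincide, else `𝔖/ℋ_∞(F)`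
  is torsion by rank–nullity over the domain `Λ`;
* `howardThmB_shape_zsmulSelf`: the body of `Howard2004_thmB` at `(D, F, X)` implies the body at
  `(D, F.zsmulSelf m, X)`; `howardBound_shape_zsmul`: the same for `Howard2004_selmerCorank_le`.

HONEST FRAMING: module bookkeeping only (no arithmetic input); 0 named facts; `#print axioms` standard
(`propext`, `Classical.choice`, `Quot.sound`). Written for the cell `bsd-cited` D-audit of Howard 2004 as
typed (D-AUDIT-r19 S3): the kernel form of "Howard's divisibility and bound are stated for an arbitrary
parametrisation, and the `∀ F` transcription is closed under `[m]`".

## References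
* [Howard2004HeegnerKolyvagin] B. Howard, *The Heegner point Kolyvagin system*, Compositio Math. 140
  (2004) 1439–1472 (held TeX `paper:arxiv-1202.6340`): §1 ("Fixing a modular parametrization …",
  Thm. B = Thm. 2 of the TeX, eq. (2)), §3.3 (`H_k`, `𝐇 = lim← H_k`), Thm. 3.3.7.
* [PerrinRiou1987BSMF] B. Perrin-Riou, Bull. SMF 115 (1987): §0 p. 401 (`S_p(L)`), §1 p. 405 (`I(H_∞)`,
  `H_∞` «dépendant du choix de la paramétrisation π»).
* [NeukirchSchmidtWingberg2008] NSW, *Cohomology of Number Fields*, Ch. V §3 (multiplicativity of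
  characteristic ideals); Bourbaki AC VII §4.5 Prop. 10.
-/

open scoped Classical

open WeierstrassCurve Literature.NumberTheory.EllipticCurves
  Literature.NumberTheory.EllipticCurves.ModularForms

universe u

/-! ## The sandwich and the divisibility -/

namespace Literature.NumberTheory.EllipticCurves

section HeegnerModuleScalingAny

variable {K : Type u} [Field K] [NumberField K] {N : ℕ} [NeZero N] {W : WeierstrassCurve ℚ}
  {p : ℕ} [Fact p.Prime] {κ : ZpExtension K p} {γ : Field.absoluteGaloisGroup K}
  {jbar : AlgebraicClosure K →+* ℂ}

/-- `proj_k ((C m) • s) = m • proj_k s` for an integer `m`: constants of `Λ` act through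
`ℤ_p → ℤ/p^k` on the `k`-th components (`proj_C`) and an integer constant acts there by integer
multiplication (`padicPi_intCast`). [cite: PerrinRiou1987BSMF, §0 p. 401 (S_p(L) = lim← S(L)^{(p^k)} as a ℤ_p-module)] -/
theorem _root_.WeierstrassCurve.LambdaAdicSelmerData.proj_C_intCast_smul
    (D : (W.baseChange K).LambdaAdicSelmerData κ γ) (m : ℤ) (k : ℕ) (s : D.S) :
    D.proj k ((PowerSeries.C ((m : ℤ) : ℤ_[p]) : IwasawaAlgebra p) • s) = m • D.proj k s := by
  rw [D.proj_C, padicPi_intCast]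

/-- **`ℋ_∞(m • F) ⊆ ℋ_∞(F)`** for every integer `m`: `ℋ̄_k(m • F) = m • ℋ̄_k(F) ⊆ ℋ̄_k(F)`
(`heegnerModuleLayer_zsmul`; a subgroup is stable under `m •`), so every generator of `ℋ_∞(m • F)` is a
generator of `ℋ_∞(F)`. [cite: Howard2004HeegnerKolyvagin, §3.3 (H_k ⊂ E(K_k) ⊗ ℤ_p the module generated by the norm points; 𝐇 = lim← H_k)] -/
theorem heegnerModule_zsmul_le [W.IsElliptic]
    (D : (W.baseChange K).LambdaAdicSelmerData κ γ) (F : HeegnerFamily N W K κ jbar)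
    (Dt' : ModularParametrizationData W N) (m : ℤ) (hφ : ∀ τ, Dt'.φ τ = m • F.Dt.φ τ) :
    heegnerModule D (F.zsmul Dt' m hφ) ≤ heegnerModule D F := by
  refine Submodule.span_mono fun s hs k ↦ ?_
  have hk : D.proj k s ∈ heegnerModuleLayer γ (F.zsmul Dt' m hφ) k := hs k
  rw [heegnerModuleLayer_zsmul, AddSubgroup.mem_map] at hk
  obtain ⟨ℓ, hℓ, hℓeq⟩ := hk
  rw [← hℓeq, zsmulAddGroupHom_apply]
  exact AddSubgroup.zsmul_mem _ hℓ m

/-- **`(C m) • ℋ_∞(F) ⊆ ℋ_∞(m • F)`**: for a generator `g` of `ℋ_∞(F)`,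
`proj_k ((C m) • g) = m • proj_k g ∈ m • ℋ̄_k(F) = ℋ̄_k(m • F)` (`proj_C_intCast_smul`,
`heegnerModuleLayer_zsmul`), and `(C m) •` commutes with the `Λ`-span.
[cite: Howard2004HeegnerKolyvagin, §3.3 (H_k, 𝐇 = lim← H_k)] -/
theorem C_smul_mem_heegnerModule_zsmul [W.IsElliptic]
    (D : (W.baseChange K).LambdaAdicSelmerData κ γ) (F : HeegnerFamily N W K κ jbar)
    (Dt' : ModularParametrizationData W N) (m : ℤ) (hφ : ∀ τ, Dt'.φ τ = m • F.Dt.φ τ)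
    {s : D.S} (hs : s ∈ heegnerModule D F) :
    (PowerSeries.C ((m : ℤ) : ℤ_[p]) : IwasawaAlgebra p) • s ∈ heegnerModule D (F.zsmul Dt' m hφ) := by
  induction hs using Submodule.span_induction with
  | mem g hg =>
    refine Submodule.subset_span fun k ↦ ?_
    rw [D.proj_C_intCast_smul, heegnerModuleLayer_zsmul]
    exact AddSubgroup.mem_map.mpr ⟨D.proj k g, hg k, zsmulAddGroupHom_apply _ _⟩
  | zero => rw [smul_zero]; exact Submodule.zero_mem _
  | add x y _ _ hx hy => rw [smul_add]; exact Submodule.add_mem _ hx hy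
  | smul a x _ hx => rw [smul_smul, mul_comm, mul_smul]; exact Submodule.smul_mem _ a hx

/-- **`𝔖/ℋ_∞(m • F)` is `Λ`-torsion when `𝔖/ℋ_∞(F)` is** (`m ≠ 0`): if `a • s ∈ ℋ_∞(F)` with `a ≠ 0` then
`(C m · a) • s ∈ (C m) • ℋ_∞(F) ⊆ ℋ_∞(m • F)` (`C_smul_mem_heegnerModule_zsmul`) and `C m · a ≠ 0` in the
domain `Λ`. [cite: PerrinRiou1987BSMF, §1 p. 405 (I(H_∞) is non-zero iff H_∞ and S_p(D_∞) have the same rank 1, i.e. iff the quotient is torsion)] -/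
theorem isTorsion_quotient_heegnerModule_zsmul [W.IsElliptic]
    (D : (W.baseChange K).LambdaAdicSelmerData κ γ) (F : HeegnerFamily N W K κ jbar)
    (Dt' : ModularParametrizationData W N) {m : ℤ} (hm0 : m ≠ 0) (hφ : ∀ τ, Dt'.φ τ = m • F.Dt.φ τ)
    (htor : Module.IsTorsion (IwasawaAlgebra p) (D.S ⧸ heegnerModule D F)) :
    Module.IsTorsion (IwasawaAlgebra p) (D.S ⧸ heegnerModule D (F.zsmul Dt' m hφ)) := by
  have hC : (PowerSeries.C ((m : ℤ) : ℤ_[p]) : IwasawaAlgebra p) ≠ 0 :=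
    (map_ne_zero_iff _ PowerSeries.C_injective).mpr (Int.cast_ne_zero.mpr hm0)
  intro x
  obtain ⟨s, rfl⟩ := Submodule.mkQ_surjective _ x
  obtain ⟨⟨a, ha⟩, has⟩ := @htor (Submodule.mkQ (heegnerModule D F) s)
  rw [Submonoid.mk_smul, Submodule.mkQ_apply, ← Submodule.Quotient.mk_smul,
    Submodule.Quotient.mk_eq_zero] at has
  refine ⟨⟨PowerSeries.C ((m : ℤ) : ℤ_[p]) * a, mul_mem (mem_nonZeroDivisors_of_ne_zero hC) ha⟩, ?_⟩
  rw [Submonoid.mk_smul, Submodule.mkQ_apply, ← Submodule.Quotient.mk_smul,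
    Submodule.Quotient.mk_eq_zero, mul_smul]
  exact C_smul_mem_heegnerModule_zsmul D F Dt' m hφ has

/-- **`I(ℋ_∞(F)) ∣ I(ℋ_∞(m • F))`** (`m ≠ 0`; `𝔖` finitely generated, `𝔖/ℋ_∞(F)` torsion): the sequence
`0 → ℋ_∞(F)/ℋ_∞(m • F) → 𝔖/ℋ_∞(m • F) → 𝔖/ℋ_∞(F) → 0` is an exact sequence of finitely generated torsion
`Λ`-modules (`heegnerModule_zsmul_le`, `isTorsion_quotient_heegnerModule_zsmul`), and characteristic
ideals are multiplicative in such (`Module.charIdeal_eq_mul_of_exact`; Bourbaki AC VII §4.5 Prop. 10).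
So rescaling the parametrisation can only make Perrin-Riou's `I(H_∞)` MORE divisible.
[cite: PerrinRiou1987BSMF, §1 p. 405 (I(H_∞) «la série caractéristique du quotient de S_p(D_∞) par H_∞», H_∞ «dépendant du choix de la paramétrisation π»)] [cite: NeukirchSchmidtWingberg2008, Ch. V §3 (multiplicativity of characteristic ideals in short exact sequences)] -/
theorem heegnerCharIdeal_dvd_zsmul [W.IsElliptic]
    (D : (W.baseChange K).LambdaAdicSelmerData κ γ) (F : HeegnerFamily N W K κ jbar)
    (Dt' : ModularParametrizationData W N) {m : ℤ} (hm0 : m ≠ 0) (hφ : ∀ τ, Dt'.φ τ = m • F.Dt.φ τ)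
    [Module.Finite (IwasawaAlgebra p) D.S]
    (htor : Module.IsTorsion (IwasawaAlgebra p) (D.S ⧸ heegnerModule D F)) :
    heegnerCharIdeal D F ∣ heegnerCharIdeal D (F.zsmul Dt' m hφ) := by
  have hle : heegnerModule D (F.zsmul Dt' m hφ) ≤ heegnerModule D F :=
    heegnerModule_zsmul_le D F Dt' m hφ
  have hM := isTorsion_quotient_heegnerModule_zsmul D F Dt' hm0 hφ htor
  have h := Module.charIdeal_eq_mul_of_exact (R := IwasawaAlgebra p) hM
    (LinearMap.ker (Submodule.factor hle)).subtype (Submodule.factor hle)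
    (Submodule.injective_subtype _) (Submodule.factor_surjective hle)
    (LinearMap.exact_subtype_ker_map _)
  exact Dvd.intro_left _ h.symm

/-- Squares: `I(ℋ_∞(F))² ∣ I(ℋ_∞(m • F))²`. [cite: PerrinRiou1987BSMF, §1 p. 405 (I(H_∞); Conj. B is stated for its square class)] -/
theorem heegnerCharIdeal_sq_dvd_zsmul [W.IsElliptic]
    (D : (W.baseChange K).LambdaAdicSelmerData κ γ) (F : HeegnerFamily N W K κ jbar)
    (Dt' : ModularParametrizationData W N) {m : ℤ} (hm0 : m ≠ 0) (hφ : ∀ τ, Dt'.φ τ = m • F.Dt.φ τ)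
    [Module.Finite (IwasawaAlgebra p) D.S]
    (htor : Module.IsTorsion (IwasawaAlgebra p) (D.S ⧸ heegnerModule D F)) :
    heegnerCharIdeal D F ^ 2 ∣ heegnerCharIdeal D (F.zsmul Dt' m hφ) ^ 2 :=
  pow_dvd_pow_of_dvd (heegnerCharIdeal_dvd_zsmul D F Dt' hm0 hφ htor) 2

/-- **The Heegner-module index can only grow under rescaling**: `ord_J I(ℋ_∞(F)) ≤ ord_J I(ℋ_∞(m • F))`
(any `m`), as `𝔖/ℋ_∞(m • F) ↠ 𝔖/ℋ_∞(F)` and local lengths are monotone under surjections.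
[cite: Howard2004HeegnerKolyvagin, §1 eq. (2) (ord_J 𝐋, 𝐋 = ch(H¹_{F_Λ}(K,𝐓)/𝐇))] -/
theorem heegnerModuleIndex_le_zsmul [W.IsElliptic]
    (D : (W.baseChange K).LambdaAdicSelmerData κ γ) (F : HeegnerFamily N W K κ jbar)
    (Dt' : ModularParametrizationData W N) (m : ℤ) (hφ : ∀ τ, Dt'.φ τ = m • F.Dt.φ τ) :
    heegnerModuleIndex D F ≤ heegnerModuleIndex D (F.zsmul Dt' m hφ) := by
  rw [heegnerModuleIndex_def, heegnerModuleIndex_def]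
  exact Module.lengthAt_le_of_surjective (Submodule.factor (heegnerModule_zsmul_le D F Dt' m hφ))
    (Submodule.factor_surjective _) _

/-- **Howard's Thm. B (c) in the tree's shape transports along rescalings.** For `𝔖 = D.S` finitely
generated, torsion-free, of `Λ`-rank one (the first clause of `Howard2004_thmB`'s body, Howard 2004
Thm. B: "`H¹_{F_Λ}(K, 𝐓)` is torsion-free of rank one") and ANY ideal `I` (there: `char(X_{Λ-tors})`):
`I ∣ I(ℋ_∞(F))²` implies `I ∣ I(ℋ_∞(m • F))²` (`m ≠ 0`). If `ℋ_∞(F) = 0` then `ℋ_∞(m • F) = 0` and the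
two characteristic ideals coincide; otherwise `ℋ_∞(F) ≠ 0` has rank `≥ 1` inside the rank-one
torsion-free `𝔖`, so `𝔖/ℋ_∞(F)` is torsion (rank–nullity over the domain `Λ`) and
`heegnerCharIdeal_sq_dvd_zsmul` applies. Howard fixes an arbitrary parametrisation (§1: "Fixing a
modular parametrization of `E` by `X_0(N)`"), so this is the kernel form of the remark that his
divisibility is insensitive to that choice in the direction that matters.
[cite: Howard2004HeegnerKolyvagin, §1 Thm. B (first sentence and (c)) and §1 ("Fixing a modular parametrization of E by X_0(N) yields a family of points P[n]")] -/
theorem dvd_heegnerCharIdeal_sq_zsmul [W.IsElliptic]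
    (D : (W.baseChange K).LambdaAdicSelmerData κ γ) (F : HeegnerFamily N W K κ jbar)
    (Dt' : ModularParametrizationData W N) {m : ℤ} (hm0 : m ≠ 0) (hφ : ∀ τ, Dt'.φ τ = m • F.Dt.φ τ)
    [Module.Finite (IwasawaAlgebra p) D.S] [NoZeroSMulDivisors (IwasawaAlgebra p) D.S]
    (hS1 : Module.finrank (IwasawaAlgebra p) D.S = 1) {I : Ideal (IwasawaAlgebra p)}
    (hI : I ∣ heegnerCharIdeal D F ^ 2) :
    I ∣ heegnerCharIdeal D (F.zsmul Dt' m hφ) ^ 2 := by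
  by_cases hbot : heegnerModule D F = ⊥
  · -- `ℋ_∞(m • F) ⊆ ℋ_∞(F) = 0`: the two quotients, hence characteristic ideals, coincide
    have hbot' : heegnerModule D (F.zsmul Dt' m hφ) = ⊥ :=
      le_bot_iff.mp (hbot ▸ heegnerModule_zsmul_le D F Dt' m hφ)
    have heq : heegnerCharIdeal D (F.zsmul Dt' m hφ) = heegnerCharIdeal D F :=
      Module.charIdeal_eq_of_linearEquiv (Submodule.quotEquivOfEq _ _ (hbot'.trans hbot.symm))
    rwa [heq]
  · -- `ℋ_∞(F) ≠ 0` in the torsion-free rank-one `𝔖`: `𝔖/ℋ_∞(F)` is torsion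
    have htor : Module.IsTorsion (IwasawaAlgebra p) (D.S ⧸ heegnerModule D F) := by
      haveI : Nontrivial (heegnerModule D F) := Submodule.nontrivial_iff_ne_bot.mpr hbot
      have hk : (1 : Cardinal) ≤ Module.rank (IwasawaAlgebra p) (heegnerModule D F) :=
        Cardinal.one_le_iff_pos.mpr rank_pos
      have hS : Module.rank (IwasawaAlgebra p) D.S = 1 := by
        rw [← Module.finrank_eq_rank, hS1, Nat.cast_one]
      have hsum := rank_quotient_add_rank_of_isDomain (heegnerModule D F)
      have hq0 : Module.rank (IwasawaAlgebra p) (D.S ⧸ heegnerModule D F) = 0 := by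
        by_contra hne
        have h1 : (1 : Cardinal) ≤ Module.rank (IwasawaAlgebra p) (D.S ⧸ heegnerModule D F) :=
          Cardinal.one_le_iff_ne_zero.mpr hne
        have h2 : (1 : Cardinal) + 1 ≤ Module.rank (IwasawaAlgebra p) D.S :=
          hsum ▸ add_le_add h1 hk
        rw [hS] at h2
        norm_num at h2
      exact rank_eq_zero_iff_isTorsion.mp hq0
    exact hI.trans (heegnerCharIdeal_sq_dvd_zsmul D F Dt' hm0 hφ htor)

/-- **The `∀ F` layout of `Howard2004_thmB` is closed under rescaling of the parametrisation**: the BODY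
of `Howard2004_thmB` at a Heegner family `F` (for data `D`, `X`) implies the body at the constructed
rescaling `F.zsmulSelf m` (datum `F.Dt.zsmul m`, `[m] ∘ φ`), for every `m ≠ 0` — so typing Howard's
divisibility for all families at once is print-consistent (Howard fixes an arbitrary parametrisation),
in contrast with the integral EQUALITY binders (`KellerYin2024.false_of_thm521_OPEN_of_witness`).
[cite: Howard2004HeegnerKolyvagin, §1 Thm. B and §1 ("Fixing a modular parametrization of E by X_0(N)")] -/
theorem howardThmB_shape_zsmulSelf [W.IsElliptic]
    (D : (W.baseChange K).LambdaAdicSelmerData κ γ) (F : HeegnerFamily N W K κ jbar)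
    (X : (W.baseChange K).SelmerDualData κ γ) {m : ℤ} (hm0 : m ≠ 0)
    (h : (Module.Finite (IwasawaAlgebra p) D.S ∧ NoZeroSMulDivisors (IwasawaAlgebra p) D.S ∧
        Module.finrank (IwasawaAlgebra p) D.S = 1) ∧
      (Module.Finite (IwasawaAlgebra p) X.X ∧ Module.finrank (IwasawaAlgebra p) X.X = 1 ∧
        Module.charIdeal (IwasawaAlgebra p) (Submodule.torsion (IwasawaAlgebra p) X.X) ∣
          heegnerCharIdeal D F ^ 2)) :
    (Module.Finite (IwasawaAlgebra p) D.S ∧ NoZeroSMulDivisors (IwasawaAlgebra p) D.S ∧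
        Module.finrank (IwasawaAlgebra p) D.S = 1) ∧
      (Module.Finite (IwasawaAlgebra p) X.X ∧ Module.finrank (IwasawaAlgebra p) X.X = 1 ∧
        Module.charIdeal (IwasawaAlgebra p) (Submodule.torsion (IwasawaAlgebra p) X.X) ∣
          heegnerCharIdeal D (F.zsmulSelf m hm0) ^ 2) := by
  obtain ⟨⟨hSfin, hStf, hS1⟩, hXfin, hX1, hc⟩ := h
  exact ⟨⟨hSfin, hStf, hS1⟩, hXfin, hX1,
    dvd_heegnerCharIdeal_sq_zsmul D F (F.Dt.zsmul m hm0) hm0 (F.Dt.φ_zsmul hm0) hS1 hc⟩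

/-- **The `∀ F` layout of `Howard2004_selmerCorank_le` is closed under rescaling**: the BODY
`corank_{ℤ_p} Sel_{p^∞}(E/K) ≤ 1 + 2 · ord_J I(ℋ_∞(F))` at `F` implies the body at `F.zsmul Dt' m`
(`heegnerModuleIndex_le_zsmul`). [cite: Howard2004HeegnerKolyvagin, §1 eq. (2)] -/
theorem howardBound_shape_zsmul [W.IsElliptic]
    (D : (W.baseChange K).LambdaAdicSelmerData κ γ) (F : HeegnerFamily N W K κ jbar)
    (Dt' : ModularParametrizationData W N) (m : ℤ) (hφ : ∀ τ, Dt'.φ τ = m • F.Dt.φ τ)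
    (h : (((W.baseChange K).selmerCorank p : ℕ) : ℕ∞) ≤ 1 + 2 * heegnerModuleIndex D F) :
    (((W.baseChange K).selmerCorank p : ℕ) : ℕ∞) ≤ 1 + 2 * heegnerModuleIndex D (F.zsmul Dt' m hφ) := by
  have hidx := heegnerModuleIndex_le_zsmul D F Dt' m hφ
  exact h.trans (by gcongr)

end HeegnerModuleScalingAny

end Literature.NumberTheory.EllipticCurves
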